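import Summits.QuantumFields.YangMills.Theorems.BalabanUVNodesN19JointLawPriceCompositionsOuterPolynomial

/-!
# YM-DAG node N19 (= NE7 proper) — THE THREE STRUCTURED COMPOSITION CLASSES AT THE SCHEME: Lipschitz links of sums of one-string observables
# of `d` strings under the uniform target (module 67's push-forward BY NAME)

Cell `pub-ymgap`, HUMAN RULING D-0062 (Track A) ∕ D-0149 (work-bound push), R141 (C) wider-strategy seat `pub-ymgap-dag-n19-e` (strategy
s3 = ALTERNATIVE CURRENCY), generation g28, module 2 (lineage module 113).  Route `Summits/QuantumFields/YangMills/Theses/BalabanUVNodes.lean`,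
cluster item K3⁸ «SpineGivenEndpointR13SepCoPHV» (stmt-QuantumFields-27366); filed `--supports` that item `--as helper` (it proves no registered
stub).  COUNT-NEUTRAL: bookkeeping BY NAME over module 67 `…N19JointLawClosedFormAtScheme` (`jointLaw_pushforward`: under the uniform `Target`
the law of `(∏os_i)_i` under `gibbs_K` is a probability law on `[−1,1]^ι` whose mixed moments are ALL `R_K`-close to those of the continuum joint
law `ν`, `R_K = (4e^{1+l₀}∕l₀)·τ_K·(1 + log⁺τ_K⁻¹)`, `τ_K = Σ_m 2vol·δ_{K+m}`), module 110 `…N19JointLawPriceCompositions`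
(`law_price_link_le_of_uniformMixedMoments`), module 111 `…N19JointLawPriceCompositionsLipschitz` (`law_price_lipschitzComposition_le`) and
module 112 `…N19JointLawPriceCompositionsOuterPolynomial` (`law_price_outerPolynomial_composition_le`).  The scheme enters ONLY through
module 67's by-name push-forward under the HYPOTHESIS `Spine.NE7.Target vol l₀ δ (schemeZ S os)` for every string (N19's DECL-target shape);
no Theses import; NOT a discharge claim.

WHY.  Modules 110–112 priced the structured composition classes for TOY laws on the cube («NO scheme object» — referee remarks on modules
110–112); module 108 §4 gave the ridge class its face at the scheme.  This module does the same for the three composition classes, so that every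
row of the CURRENCY-MAP's «UNIFORM MOMENTS → JOINT LAW» entry has a by-name form a consumer can cite: for a finite family of strings
`os : ι → List O` (`d = |ι|`) with continuum joint law `ν` (p558060 ∕ module 67), at every step `K` with `0 ≤ R_K`:
§1 `abs_integral_link_sub_jointLaw_le_of_uniformTarget` — a `K_h`-Lipschitz, `G_h`-bounded link of an additive POLYNOMIAL statistic
   `Σ_i p_i(∏os_i)` (`deg p_i ≤ D`, mass `≤ Λ`, `|p_i| ≤ B ≤ Λ`): `≤ 2K_h dB π∕m + G_h·m9^m·(Λ∕B)^{2m}·R_K` for every `m ≥ 1` (module 110).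
§2 ★ `abs_integral_lipschitzComposition_sub_jointLaw_le_of_uniformTarget` — a `K`-Lipschitz, `G`-bounded link of a sum of `K_φ`-Lipschitz,
   `G_φ`-bounded one-string observables `Σ_i φ_i(∏os_i)`: `≤ 2Kd K_φπ∕m₁ + 2K dB₁ π∕m₂ + G·m₂9^{m₂}·(Λ₁∕B₁)^{2m₂}·R_K` for all `m₁, m₂ ≥ 1`
   (module 111; `B₁ = G_φ + πK_φ∕m₁`, `Λ₁ = max(B₁, G_φ m₁9^{m₁})`) — the `O(d∕√(log R_K⁻¹))` road.
§3 ★ `abs_integral_polyLink_sub_jointLaw_le_of_uniformTarget` — a POLYNOMIAL link `q(·∕(dM))` (`deg q ≤ D`, mass `Λ_q`, `K`-Lipschitz) of the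
   same statistic: `≤ 2K·d·(K_φπ∕m₁) + Λ_q·(m₁9^{m₁})^D·R_K` for every `m₁ ≥ 1` (module 112) — the `O(dD∕log R_K⁻¹)` road.
READING (honest): under the uniform target, «Lipschitz profile of a sum of one-string Lipschitz observables» of `d` strings converges to its
continuum value at `≲ d∕√(log R_K⁻¹)` in general and at `≲ d∕log R_K⁻¹` as soon as the profile or the one-string observables are polynomial;
the desk's certified LP numerics (CURRENCY-MAP v7) indicate the general case is in truth `≍ d∕log R_K⁻¹` as well (conjecture; not typed).

HONEST FRAMING (binding).  Bookkeeping; CONDITIONAL on the uniform `Target` hypothesis and on the existence of the continuum joint law `ν`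
(both displayed as hypotheses, inhabited trivially only); nothing of Bałaban's instantiated; NE7 NOT PRINTED, NOT proved; N19 NOT discharged;
count-neutral.  One finite `T⁴` programme at fixed `ε`; nothing continuum ∕ `ℝ⁴` ∕ OS ∕ mass-gap ∕ Clay.  0 `def` ∕ 0 `sorry`.
-/

noncomputable section

open Real Finset MeasureTheory Polynomial Filter Topology

namespace Summit.QuantumFields.YangMills.Theorems.BalabanUVNodesN19JointLawPriceCompositionsAtScheme

open Literature.MathematicalPhysics.QuantumFieldTheory.Balaban1983to89
open T4GenFunBounds (prodObs gibbsMeasure schemeZ)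
open Missing (TorusScheme)
open Summit.QuantumFields.BalabanUV.T4Continuum.Spine
open Summit.QuantumFields.YangMills.Theorems.BalabanUVNodesN19JointLawClosedFormAtScheme (jointLaw_pushforward)
open Summit.QuantumFields.YangMills.Theorems.BalabanUVNodesN19JointLawPriceCompositions (law_price_link_le_of_uniformMixedMoments)
open Summit.QuantumFields.YangMills.Theorems.BalabanUVNodesN19JointLawPriceCompositionsLipschitz (law_price_lipschitzComposition_le)
open Summit.QuantumFields.YangMills.Theorems.BalabanUVNodesN19JointLawPriceCompositionsOuterPolynomial
  (law_price_outerPolynomial_composition_le)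

variable {ι : Type*} [Fintype ι] [DecidableEq ι] [Nonempty ι]
variable {G : Type*} [GaugeGroup G] [MeasurableSpace G] [RegularGaugeGroup G] [HaarData G] {O : Type*}
  (S : TorusScheme G O) (hβ : ∀ K, 0 ≤ S.β K) (hm : ∀ K o, Measurable (S.obs K o)) (h1 : ∀ K o U, |S.obs K o U| ≤ 1)
include hβ hm h1

/-! ## §1 Lipschitz links of additive polynomial statistics of `d` strings (module 110 at the scheme) [bookkeeping] -/

/-- **LIPSCHITZ LINK OF A POLYNOMIAL STATISTIC OF `d` STRINGS AT THE SCHEME.**  Under `Spine.NE7.Target vol l₀ δ (schemeZ S os)` for EVERY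
string (`0 < l₀`), for a finite family `os : ι → List O` with a continuum joint law `ν` on `[−1,1]^ι` receiving all continuous functionals,
one-variable polynomials `p_i` (`deg ≤ D`, coefficient mass `≤ Λ`, `|p_i| ≤ B` on `[−1,1]`, `0 < B ≤ Λ`), a continuous link `h`,
`K_h`-Lipschitz and `G_h`-bounded on `[−dB, dB]`, every `m ≥ 1` and every step `K` (with `R_K` as in the header):
`|∫ h(Σ_i p_i(∏os_i)) dgibbs_K − ∫ h(Σ_i p_i(x_i)) dν| ≤ 2K_h(dB)(π∕m) + G_h·(m9^m)·((Λ∕B)^{2m}·R_K)`.  CONDITIONAL on the uniform `Target`;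
nothing of Bałaban's instantiated. [bookkeeping] -/
theorem abs_integral_link_sub_jointLaw_le_of_uniformTarget {vol l₀ : ℝ} {δ : ℕ → ℝ}
    (hl₀ : 0 < l₀) (hT : ∀ os : List O, NE7.Target vol l₀ δ (schemeZ S os)) (os : ι → List O) (ν : Measure (ι → ℝ)) [IsProbabilityMeasure ν]
    (hν1 : ν (Set.pi Set.univ (fun _ : ι => Set.Icc (-1 : ℝ) 1))ᶜ = 0)
    (hν : ∀ f : (ι → ℝ) → ℝ, Continuous f →
      Tendsto (fun K => ∫ U, f (fun i => prodObs S K (os i) U) ∂gibbsMeasure (S.P K) (S.β K)) atTop (𝓝 (∫ x, f x ∂ν)))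
    (p : ι → ℝ[X]) {D : ℕ} (hp : ∀ i, (p i).natDegree ≤ D) {Λ B : ℝ} (hB0 : 0 < B) (hBΛ : B ≤ Λ)
    (hΛ : ∀ i, ∑ k ∈ range (D + 1), |(p i).coeff k| ≤ Λ) (hB : ∀ (i : ι) (s : ℝ), s ∈ Set.Icc (-1 : ℝ) 1 → |(p i).eval s| ≤ B)
    {h : ℝ → ℝ} (hh : Continuous h) {Kh Gh : ℝ} (hK0 : 0 ≤ Kh)
    (hK : ∀ s s' : ℝ, s ∈ Set.Icc (-(Fintype.card ι * B)) (Fintype.card ι * B) →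
      s' ∈ Set.Icc (-(Fintype.card ι * B)) (Fintype.card ι * B) → |h s - h s'| ≤ Kh * |s - s'|)
    (hG : ∀ s : ℝ, s ∈ Set.Icc (-(Fintype.card ι * B)) (Fintype.card ι * B) → |h s| ≤ Gh) {m : ℕ} (hm0 : 0 < m) (K : ℕ) :
    |∫ U, h (∑ i, (p i).eval (prodObs S K (os i) U)) ∂gibbsMeasure (S.P K) (S.β K) - ∫ x, h (∑ i, (p i).eval (x i)) ∂ν| ≤
      2 * (Kh * (Fintype.card ι * B)) * (π / m) +
        Gh * (m * 9 ^ m) * ((Λ / B) ^ (2 * m) *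
          (4 * Real.exp (1 + l₀) / l₀ * (∑' j, 2 * (vol * δ (K + j))) * (1 + Real.posLog (∑' j, 2 * (vol * δ (K + j)))⁻¹))) := by
  obtain ⟨P, iP, hPc, hint, hR0, hmom⟩ := jointLaw_pushforward S hβ hm h1 hl₀ hT os ν hν K
  have hc : Continuous fun x : ι → ℝ => h (∑ i, (p i).eval (x i)) :=
    hh.comp (continuous_finsetSum _ fun i _ => (Polynomial.continuous _).comp (continuous_apply i))
  rw [← hint hc]
  exact law_price_link_le_of_uniformMixedMoments hPc hν1 hR0 hmom p hp hB0 hBΛ hΛ hB hh hK0 hK hG hm0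

/-! ## §2 ★ Lipschitz links of sums of Lipschitz one-string observables (module 111 at the scheme) [bookkeeping] -/

/-- ★ **LIPSCHITZ LINK OF A SUM OF LIPSCHITZ ONE-STRING OBSERVABLES AT THE SCHEME: the `O(d∕√(log R_K⁻¹))` road.**  Under the uniform `Target`
(as in §1), for one-string observables `φ_i` (continuous, `K_φ`-Lipschitz and `G_φ`-bounded on `[−1,1]`, `0 ≤ K_φ`, `0 < G_φ`) and a continuous
link `h`, `K`-Lipschitz and `G`-bounded on `[−d(G_φ + πK_φ), d(G_φ + πK_φ)]`, all `m₁, m₂ ≥ 1` and every step `K`: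
`|∫ h(Σ_i φ_i(∏os_i)) dgibbs_K − ∫ h(Σ_i φ_i(x_i)) dν| ≤ 2K·d·(K_φπ∕m₁) + (2K(dB₁)(π∕m₂) + G·(m₂9^{m₂})·((Λ₁∕B₁)^{2m₂}·R_K))` with
`B₁ = G_φ + K_φπ∕m₁`, `Λ₁ = max(B₁, G_φ m₁9^{m₁})` — module 111 at `r = R_K` on module 67's push-forward.  At `m₁ = m₂ ≍ √(log R_K⁻¹)` this is
`O(d∕√(log R_K⁻¹))`.  CONDITIONAL on the uniform `Target`; nothing of Bałaban's instantiated. [bookkeeping] -/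
theorem abs_integral_lipschitzComposition_sub_jointLaw_le_of_uniformTarget {vol l₀ : ℝ} {δ : ℕ → ℝ}
    (hl₀ : 0 < l₀) (hT : ∀ os : List O, NE7.Target vol l₀ δ (schemeZ S os)) (os : ι → List O) (ν : Measure (ι → ℝ)) [IsProbabilityMeasure ν]
    (hν1 : ν (Set.pi Set.univ (fun _ : ι => Set.Icc (-1 : ℝ) 1))ᶜ = 0)
    (hν : ∀ f : (ι → ℝ) → ℝ, Continuous f →
      Tendsto (fun K => ∫ U, f (fun i => prodObs S K (os i) U) ∂gibbsMeasure (S.P K) (S.β K)) atTop (𝓝 (∫ x, f x ∂ν)))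
    {φ : ι → ℝ → ℝ} (hφc : ∀ i, Continuous (φ i)) {Kφ Gφ : ℝ} (hKφ0 : 0 ≤ Kφ) (hGφ0 : 0 < Gφ)
    (hφK : ∀ (i : ι) (x y : ℝ), x ∈ Set.Icc (-1 : ℝ) 1 → y ∈ Set.Icc (-1 : ℝ) 1 → |φ i x - φ i y| ≤ Kφ * |x - y|)
    (hφG : ∀ (i : ι) (x : ℝ), x ∈ Set.Icc (-1 : ℝ) 1 → |φ i x| ≤ Gφ)
    {h : ℝ → ℝ} (hh : Continuous h) {K G : ℝ} (hK0 : 0 ≤ K)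
    (hK : ∀ s s' : ℝ, s ∈ Set.Icc (-(Fintype.card ι * (Gφ + π * Kφ))) (Fintype.card ι * (Gφ + π * Kφ)) →
      s' ∈ Set.Icc (-(Fintype.card ι * (Gφ + π * Kφ))) (Fintype.card ι * (Gφ + π * Kφ)) → |h s - h s'| ≤ K * |s - s'|)
    (hG : ∀ s : ℝ, s ∈ Set.Icc (-(Fintype.card ι * (Gφ + π * Kφ))) (Fintype.card ι * (Gφ + π * Kφ)) → |h s| ≤ G)
    {m₁ m₂ : ℕ} (hm₁ : 0 < m₁) (hm₂ : 0 < m₂) (Kstep : ℕ) :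
    |∫ U, h (∑ i, φ i (prodObs S Kstep (os i) U)) ∂gibbsMeasure (S.P Kstep) (S.β Kstep) - ∫ x, h (∑ i, φ i (x i)) ∂ν| ≤
      2 * (K * (Fintype.card ι * (Kφ * (π / m₁)))) +
        (2 * (K * (Fintype.card ι * (Gφ + Kφ * (π / m₁)))) * (π / m₂) +
          G * (m₂ * 9 ^ m₂) * ((max (Gφ + Kφ * (π / m₁)) (Gφ * (m₁ * 9 ^ m₁)) / (Gφ + Kφ * (π / m₁))) ^ (2 * m₂) *
            (4 * Real.exp (1 + l₀) / l₀ * (∑' j, 2 * (vol * δ (Kstep + j))) * (1 + Real.posLog (∑' j, 2 * (vol * δ (Kstep + j)))⁻¹)))) := by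
  obtain ⟨P, iP, hPc, hint, hR0, hmom⟩ := jointLaw_pushforward S hβ hm h1 hl₀ hT os ν hν Kstep
  have hc : Continuous fun x : ι → ℝ => h (∑ i, φ i (x i)) :=
    hh.comp (continuous_finsetSum _ fun i _ => (hφc i).comp (continuous_apply i))
  rw [← hint hc]
  exact law_price_lipschitzComposition_le hPc hν1 hR0 hmom hφc hKφ0 hGφ0 hφK hφG hh hK0 hK hG hm₁ hm₂

/-! ## §3 ★ Polynomial links of sums of Lipschitz one-string observables (module 112 at the scheme) [bookkeeping] -/

/-- ★ **POLYNOMIAL LINK OF A SUM OF LIPSCHITZ ONE-STRING OBSERVABLES AT THE SCHEME: the `O(dD∕log R_K⁻¹)` road.**  Under the uniform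
`Target` (as in §1), for one-string observables `φ_i` as in §2 (`M = G_φ + πK_φ`), a polynomial link `h(s) = q(s∕(dM))` with `deg q ≤ D`,
coefficient mass `≤ Λ_q`, `h` `K`-Lipschitz on `[−dM, dM]` (`0 ≤ K`), every `m₁ ≥ 1` and every step `K`:
`|∫ q((Σ_i φ_i(∏os_i))∕(dM)) dgibbs_K − ∫ q((Σ_i φ_i(x_i))∕(dM)) dν| ≤ 2·(K·(d·(K_φ(π∕m₁)))) + Λ_q·(m₁9^{m₁})^D·R_K` — module 112 at
`r = R_K` on module 67's push-forward; at `m₁ ≍ log R_K⁻¹∕(D log(9m₁))` this is `O(dD∕log R_K⁻¹)`: LINEAR in `d` at RATE `1∕log R_K⁻¹`.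
CONDITIONAL on the uniform `Target`; nothing of Bałaban's instantiated. [bookkeeping] -/
theorem abs_integral_polyLink_sub_jointLaw_le_of_uniformTarget {vol l₀ : ℝ} {δ : ℕ → ℝ}
    (hl₀ : 0 < l₀) (hT : ∀ os : List O, NE7.Target vol l₀ δ (schemeZ S os)) (os : ι → List O) (ν : Measure (ι → ℝ)) [IsProbabilityMeasure ν]
    (hν1 : ν (Set.pi Set.univ (fun _ : ι => Set.Icc (-1 : ℝ) 1))ᶜ = 0)
    (hν : ∀ f : (ι → ℝ) → ℝ, Continuous f →
      Tendsto (fun K => ∫ U, f (fun i => prodObs S K (os i) U) ∂gibbsMeasure (S.P K) (S.β K)) atTop (𝓝 (∫ x, f x ∂ν)))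
    {φ : ι → ℝ → ℝ} (hφc : ∀ i, Continuous (φ i)) {Kφ Gφ : ℝ} (hKφ0 : 0 ≤ Kφ) (hGφ0 : 0 < Gφ)
    (hφK : ∀ (i : ι) (x y : ℝ), x ∈ Set.Icc (-1 : ℝ) 1 → y ∈ Set.Icc (-1 : ℝ) 1 → |φ i x - φ i y| ≤ Kφ * |x - y|)
    (hφG : ∀ (i : ι) (x : ℝ), x ∈ Set.Icc (-1 : ℝ) 1 → |φ i x| ≤ Gφ)
    (q : ℝ[X]) {D : ℕ} (hq : q.natDegree ≤ D) {Λq : ℝ} (hΛq : ∑ k ∈ range (D + 1), |q.coeff k| ≤ Λq) {K : ℝ} (hK0 : 0 ≤ K)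
    (hK : ∀ s s' : ℝ, s ∈ Set.Icc (-(Fintype.card ι * (Gφ + π * Kφ))) (Fintype.card ι * (Gφ + π * Kφ)) →
      s' ∈ Set.Icc (-(Fintype.card ι * (Gφ + π * Kφ))) (Fintype.card ι * (Gφ + π * Kφ)) →
      |q.eval (s / (Fintype.card ι * (Gφ + π * Kφ))) - q.eval (s' / (Fintype.card ι * (Gφ + π * Kφ)))| ≤ K * |s - s'|)
    {m₁ : ℕ} (hm₁ : 0 < m₁) (Kstep : ℕ) :
    |∫ U, q.eval ((∑ i, φ i (prodObs S Kstep (os i) U)) / (Fintype.card ι * (Gφ + π * Kφ))) ∂gibbsMeasure (S.P Kstep) (S.β Kstep) -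
        ∫ x, q.eval ((∑ i, φ i (x i)) / (Fintype.card ι * (Gφ + π * Kφ))) ∂ν| ≤
      2 * (K * (Fintype.card ι * (Kφ * (π / m₁)))) +
        Λq * ((m₁ : ℝ) * 9 ^ m₁) ^ D *
          (4 * Real.exp (1 + l₀) / l₀ * (∑' j, 2 * (vol * δ (Kstep + j))) * (1 + Real.posLog (∑' j, 2 * (vol * δ (Kstep + j)))⁻¹)) := by
  obtain ⟨P, iP, hPc, hint, hR0, hmom⟩ := jointLaw_pushforward S hβ hm h1 hl₀ hT os ν hν Kstep
  have hc : Continuous fun x : ι → ℝ => q.eval ((∑ i, φ i (x i)) / (Fintype.card ι * (Gφ + π * Kφ))) :=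
    (Polynomial.continuous q).comp ((continuous_finsetSum _ fun i _ => (hφc i).comp (continuous_apply i)).div_const _)
  rw [← hint hc]
  exact law_price_outerPolynomial_composition_le hPc hν1 hR0 hmom hφc hKφ0 hGφ0 hφK hφG q hq hΛq hK0 hK hm₁

end Summit.QuantumFields.YangMills.Theorems.BalabanUVNodesN19JointLawPriceCompositionsAtScheme

end
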